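import Mathlib
import HarnessLib
import Summits.RiemannHypothesis.RiemannHypothesis.Theses.WeilParity
import Literature.NumberTheory.LFunctions.WeilGroundEnergyParitySplit
import Literature.NumberTheory.LFunctions.WeilWindowSuzukiProofs
import Summits.RiemannHypothesis.RiemannHypothesis.Theorems.WeilParityEvenWinsArchRungs

/-!
# Route WeilParity, crux `EvenWinsArch` (stmt-RiemannHypothesis-15433): the proof

**Theorem (`evenWinsArch_proof`).** For every prime-free window `0 < a ≤ (log 2)/2`, every odd
`L²`-normalised Weil test function `o` supported in `[-a, a]` and every `δ > 0` there is an even normalised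
test function `e` on the same window with `Re Q(e) ≤ Re Q(o) + δ` (`Q = weilQuadratic`): the even sector of
Weil's quadratic form wins on the whole archimedean range. RH-free.

## Proof (line `birth` of the crux, "parity ladder"; lead's method: dilation transport)

In the tree's ground-energy language the statement is the ORDER of the two sector bottoms,
`ε_ev(a) ≤ ε_od(a)` (`evenWinsAt_of_le`: `csInf` approximation on the nonempty even sphere). Both bottoms
are antitone in the window (Bombieri 2000, Thm 5), so a two-window certificate `ε_ev(w) ≤ ε_od(w')`,
`w < w'`, settles the order on the whole cell `[w, w']` (`le_of_bracket`). The bottom cell `(0, 1/100]` is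
Suzuki's small-window gap, in the tree (`weilGroundEnergy_add_le_of_integral_eq_zero`, `le_of_small`); the
rest of `(0, (log 2)/2]` is climbed by the seven rungs
`1/100 < 3/200 < 1/40 < 1/20 < 1/10 < 1/5 < 3/10 < (log 2)/2`
(`…Theorems.WeilParity.EvenWinsArch.stub_logLadder / stub_midLadder / stub_topLadder`, file
`WeilParityEvenWinsArchRungs.lean`), each obtained by DILATION TRANSPORT of the two in-tree certificates at
the top window `A = (log 2)/2` — the kernel-checked odd-block floor `θ = 1/20` (`weilGapCert`) and the
parabola-bump ceiling — along the scale covariance of the prime-free jump form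
`𝓔(g) = ∫₀^∞ w(t) D_t(g) dt`, `w = e^{t/2}/(2 sinh t)`:
* odd floor `ε_od(a) ≥ 1/20 + 2 (T(2a) − T(2A)) − 2 (sinh a − a) − (A − a)` (`stub_oddFloor`: the kernel
  `Φ(t) = t w(t)` is `¼`-Lipschitz from above, `stub_phiLipschitz`; dilation identity `stub_dilationEnergy`;
  increment average `stub_incrementAverage`), `T(x) = ∫_x^∞ w`;
* even ceiling `ε(r) ≤ 31/30 + 7r/12 + (10/3) r (1 + r²/36)² + 2 T(2r) − M` (`stub_evenCeiling`: the tree's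
  form-domain Rayleigh principle on the rescaled bump `trialFun (x/3r)`, `stub_bumpEnergy`, `stub_bumpData`);
* the rung inequalities are then elementary (`2 (T(2w) − T(2w')) ≤ log(w'/w) + (w' − w)`,
  `T(log 2) ≤ 1.49686` (`stub_archTailLogTwo`), `M ≥ 5.367`).

## References
* E. Bombieri, Rend. Mat. Acc. Lincei (9) 11 (2000), §4 Thm 5 (monotonicity in the window).
* M. Suzuki (2026), arXiv:2606.09096, Thm 1.4 (the small-window gap, tree `Suzuki2026_thm_1_4_holds`).
* H. Yoshida, Adv. Stud. Pure Math. 21 (1992), §6 (odd/even blocks at `a = (log 2)/2`).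
-/

namespace Summit.RiemannHypothesis.RiemannHypothesis.Theorems.WeilParity

-- `Summit.RiemannHypothesis.RiemannHypothesis.…` repeats a namespace component by design (D-0017 layout).
set_option linter.dupNamespace false

open Set MeasureTheory
open Literature.NumberTheory.LFunctions

/-- **ORDER ⇒ MATCHING** (the crux's junk-free form at one window `a > 0` from the order of the sector
bottoms): if `ε_ev(a) ≤ ε_od(a)` then every odd normalised test `o` on `[-a, a]` is matched up to any
`δ > 0` by an even normalised test `e` with `Re Q(e) ≤ Re Q(o) + δ` (`ε_od(a) ≤ Re Q(o)`, and `ε_ev(a)` is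
the infimum of a nonempty set, so some even sphere element is `< ε_ev(a) + δ`). -/
theorem evenWinsAt_of_le {a : ℝ} (ha : 0 < a)
    (hle : weilEvenGroundEnergy a ≤ weilOddGroundEnergy a) :
    ∀ o : ℝ → ℂ, IsWeilTest o → tsupport o ⊆ Set.Icc (-a) a → (∀ t, o (-t) = -o t) →
      ∫ t, ‖o t‖ ^ 2 = (1 : ℝ) → ∀ δ : ℝ, 0 < δ → ∃ e : ℝ → ℂ, IsWeilTest e ∧
        tsupport e ⊆ Set.Icc (-a) a ∧ (∀ t, e (-t) = e t) ∧ ∫ t, ‖e t‖ ^ 2 = (1 : ℝ) ∧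
        (weilQuadratic e).re ≤ (weilQuadratic o).re + δ := by
  intro o ho hos hodd hon δ hδ
  have hodd_le : weilOddGroundEnergy a ≤ (weilQuadratic o).re :=
    weilOddGroundEnergy_le ho hos hodd hon
  have hne := weilWindowSphereValues_even_nonempty ha
  have hlt : sInf (weilWindowSphereValues (fun g ↦ ∀ t, g (-t) = g t) a) <
      weilEvenGroundEnergy a + δ := by
    rw [← weilEvenGroundEnergy_eq_sInf]
    linarith
  obtain ⟨x, hx, hxlt⟩ := exists_lt_of_csInf_lt hne hlt
  obtain ⟨e, he, hes, hev, hen, rfl⟩ := hx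
  exact ⟨e, he, hes, hev, hen, by linarith⟩

/-- **MONOTONE BRACKETING** (the engine of the ladder): an even ceiling at the smaller window `α` below
the odd floor at the larger window `β` settles the order at every window in between,
`ε_ev(a) ≤ ε_ev(α) ≤ ε_od(β) ≤ ε_od(a)` for `0 < α ≤ a ≤ β` (both bottoms are antitone in the window,
Bombieri 2000 Thm 5). -/
theorem le_of_bracket {α β a : ℝ} (hα : 0 < α) (hαa : α ≤ a) (haβ : a ≤ β)
    (h : weilEvenGroundEnergy α ≤ weilOddGroundEnergy β) :
    weilEvenGroundEnergy a ≤ weilOddGroundEnergy a :=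
  calc weilEvenGroundEnergy a ≤ weilEvenGroundEnergy α := weilEvenGroundEnergy_antitone hα hαa
    _ ≤ weilOddGroundEnergy β := h
    _ ≤ weilOddGroundEnergy a := weilOddGroundEnergy_antitone (lt_of_lt_of_le hα hαa) haβ

/-- **THE SUZUKI RANGE, from the tree**: for `0 < a ≤ 1/100`, `ε_ev(a) ≤ ε_od(a)` (indeed with the gap
`1/10`: `ε(a) + 1/10 ≤ Re Q(o)` for odd normalised `o` by `weilGroundEnergy_add_le_of_integral_eq_zero`
— odd functions are mean-zero — so `ε(a) + 1/10 ≤ ε_od(a)`, and `ε(a) = min (ε_ev(a), ε_od(a))`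
(`weilGroundEnergy_eq_min_even_odd`) forces the minimum to be the even one). -/
theorem le_of_small {a : ℝ} (ha : 0 < a) (ha' : a ≤ 1 / 100) :
    weilEvenGroundEnergy a ≤ weilOddGroundEnergy a := by
  have hgap : weilGroundEnergy a + 1 / 10 ≤ weilOddGroundEnergy a := by
    refine le_weilOddGroundEnergy_of_forall ha fun g hg hs hodd hn ↦ ?_
    exact weilGroundEnergy_add_le_of_integral_eq_zero hg ha ha' hs hn
      (EvenWinsArch.oddFloor_integral_eq_zero_of_odd hodd)
  have hmin := weilGroundEnergy_eq_min_even_odd a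
  by_contra hlt
  push Not at hlt
  rw [min_eq_right hlt.le] at hmin
  linarith

/-- Rung 7 from its even half (the odd half `1/20 ≤ ε_od((log 2)/2)` being the tree's kernel-checked gap
certificate, `EvenWinsArch.oddFloor_top`). -/
theorem topRung_of_evenCeiling (h : weilEvenGroundEnergy (3 / 10) ≤ 1 / 20) :
    weilEvenGroundEnergy (3 / 10) ≤ weilOddGroundEnergy (Real.log 2 / 2) :=
  h.trans EvenWinsArch.oddFloor_top

/-- **THE LADDER ARGUMENT**: the seven rung certificates and the tree's Suzuki range give the order of the
sector bottoms on every prime-free window, `ε_ev(a) ≤ ε_od(a)` for `0 < a ≤ (log 2)/2` — locate the cell of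
`a` and bracket. -/
theorem evenOrder {a : ℝ} (ha : 0 < a) (hle : a ≤ Real.log 2 / 2) :
    weilEvenGroundEnergy a ≤ weilOddGroundEnergy a := by
  obtain ⟨r1, r2, r3⟩ := EvenWinsArch.stub_logLadder
  obtain ⟨r4, r5⟩ := EvenWinsArch.stub_midLadder
  obtain ⟨r6, r7⟩ := EvenWinsArch.stub_topLadder
  rcases le_or_gt a (1 / 100) with h0 | h0
  · exact le_of_small ha h0
  rcases le_or_gt a (3 / 200) with h1 | h1
  · exact le_of_bracket (by norm_num) h0.le h1 r1
  rcases le_or_gt a (1 / 40) with h2 | h2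
  · exact le_of_bracket (by norm_num) h1.le h2 r2
  rcases le_or_gt a (1 / 20) with h3 | h3
  · exact le_of_bracket (by norm_num) h2.le h3 r3
  rcases le_or_gt a (1 / 10) with h4 | h4
  · exact le_of_bracket (by norm_num) h3.le h4 r4
  rcases le_or_gt a (1 / 5) with h5 | h5
  · exact le_of_bracket (by norm_num) h4.le h5 r5
  rcases le_or_gt a (3 / 10) with h6 | h6
  · exact le_of_bracket (by norm_num) h5.le h6 r6
  · exact le_of_bracket (by norm_num) h6.le hle (topRung_of_evenCeiling r7)

/-- **Crux `EvenWinsArch` of route WeilParity (stmt-RiemannHypothesis-15433).** For `0 < a ≤ (log 2)/2`,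
every odd `L²`-normalised Weil test `o` on `[-a, a]` is matched up to any `δ > 0` by an even normalised one
`e` with `Re Q(e) ≤ Re Q(o) + δ`. Proof: the order of the sector bottoms (`evenOrder`, the parity ladder) and
the order-to-matching glue `evenWinsAt_of_le`. -/
theorem evenWinsArch_proof : Summit.RiemannHypothesis.RiemannHypothesis.Theses.WeilParity.EvenWinsArch := by
  intro a ha hle o ho hos hodd hon δ hδ
  exact evenWinsAt_of_le ha (evenOrder ha hle) o ho hos hodd hon δ hδ

end Summit.RiemannHypothesis.RiemannHypothesis.Theorems.WeilParity
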